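import Mathlib

/-!
# `MatrixDescartes` census — DOOR A tool: the CROSS-PRODUCT PENCIL of a `2 × 2` real symmetric lacunary pencil
# (gauge-existence / tangency discriminant as the determinant of an explicit `(2, C(K,2))` pencil; revival lemma; all `K`, all supports)

HONEST FRAMING.  Object-search cell `pub-symmetroid`, door-A seat `val-sym-door-p4` (gen 17); items stmt-ValiantsHypothesis-19979 `DoorA26` /
19980 `DoorA34` (OPEN, typed, never asserted); helper `--supports 19979`, NO closure claim, no definition.  Nothing here bounds `ζ_sym(2,6)`, decides
a door, or bears on `MatrixDescartes` (stmt-ValiantsHypothesis-18050) / `VP ≠ VNP`.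

DICTIONARY.  `(Sym₂(ℝ), det)` is Minkowski space `ℝ^{1,2}` with the polar pairing `⟪S,T⟫ := (det(S+T) − det S − det T)/2` (`⟪S,S⟫ = det S`).  For
symmetric `S, T` put `X(S,T) := S·J·T − T·J·S`, `J = !![0,1;-1,0]` (written out in every statement; no definition).  §1: `X(S,T)` is symmetric,
the LORENTZIAN LAGRANGE IDENTITY `⟪X(S,T), X(U,V)⟫ = 4(⟪S,U⟫⟪T,V⟫ − ⟪S,V⟫⟪T,U⟫)` holds, so `det X(S,T) = 4(det S·det T − ⟪S,T⟫²) = 4·Gram(S,T)`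
(and plainly `X(A, B − t•A) = X(A,B)`: gauge invariance).  §2 (`2 × 2` linear algebra): for `det B < 0` the line `A + s•B` contains a matrix of positive
determinant (for symmetric matrices: a DEFINITE one) iff `Gram(A,B) < 0` iff `det X(A,B) < 0` (`exists_det_pos_iff`, `exists_definite_gauge_iff`).
§3 THE CROSS-PRODUCT PENCIL: for `F(x) = ∑ₗ x^{dₗ}Sₗ` and its Euler derivative `(θF)(x) = ∑ₖ dₖx^{dₖ}Sₖ`,
`F·J·θF − θF·J·F = ∑ₗ∑ₖ ((dₖ − dₗ)x^{dₗ+dₖ}) • (Sₗ·J·Sₖ)` (`crossPencil_eq`; grouping `(l,k)` with `(k,l)`: `∑_{l<k} (dₖ − dₗ)x^{dₗ+dₖ} X(Sₗ,Sₖ)`, a real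
symmetric lacunary pencil `F̃` on the OFF-DIAGONAL pair sums with `C(K,2)` letters) and `det F̃ = 4·Gram(F, θF)` (`det_crossPencil`); since
`X(θF − θ'F, F) = X(θF, F)`, the sign of `det F̃(x)` decides (where `F(x)` is indefinite) whether SOME gauged Euler derivative `Q_θ'(x) = θF(x) − θ'F(x)` is
definite.  §4 REVIVAL LEMMA `exists_crossDet_nonneg_of_revival`: on a gap `[r, r'] ⊂ (0,∞)` with `det F ≤ 0`, if a negative definite gauge is
available at `r` and a positive definite one at `r'`, then `det(θF·J·F − F·J·θF) ≥ 0` somewhere in `[r, r']` (connectedness of `[r,r']`: the two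
availability sets are open, disjoint where `det F ≤ 0` (`not_both_gauges`), and would cover the gap if `det F̃ < 0` throughout).  §5: at a singular
non-zero `F(r)` with kernel vector `u` the available gauge sign IS the inertia kit's TYPE `sign(uᵀ(θF)(r)u)` (`exists_negGauge_of_negType`,
`exists_posGauge_of_posType`).  READING (memo DOOR-A26-P4G17 §2.4–2.5): consecutive det-roots of opposite type across an indefinite gap («revivals» of the
index formula `#roots = |Δν| + 2·min(N⁻,N⁺)`) each cost a point of the gap where `F̃` is semidefinite, while `det F̃ < 0` at the roots themselves; a
one-branch twenty at `(2,6)` would force `≥ 20` roots with multiplicity of its cross-product `(2,15)`-pencil inside `(r₁, r₂₀)` — that count is a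
paper corollary, NOT typed here.  [folklore] (Lagrange identity in `ℝ^{1,2}`; connectedness of an interval); Mathlib only; axioms standard; no `sorry`,
no definitions.
-/

-- the D-0017 layout repeats a namespace component (single-conjunct summit); the `dupNamespace` linter flags it; name mandated.
set_option linter.dupNamespace false

namespace Summit.ValiantsHypothesis.ValiantsHypothesis.Theorems.LacunarySymmetroidMatrixDescartes.Census.CrossPencil

open Matrix Finset
open scoped BigOperators
/-! ## §1 The Lorentzian cross product on `Sym₂(ℝ)` -/

/-- `X(S,T) = S·J·T − T·J·S` is symmetric for symmetric `S, T` (`J = !![0,1;-1,0]`). [folklore] -/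
theorem cross_isSymm (S T : Matrix (Fin 2) (Fin 2) ℝ) (hS : S.IsSymm) (hT : T.IsSymm) :
    (S * !![0, 1; -1, 0] * T - T * !![0, 1; -1, 0] * S).IsSymm := by
  have hS10 : S 1 0 = S 0 1 := by simpa using congrFun (congrFun hS 0) 1
  have hT10 : T 1 0 = T 0 1 := by simpa using congrFun (congrFun hT 0) 1
  ext i j
  fin_cases i <;> fin_cases j <;>
    simp [Matrix.transpose_apply, Matrix.sub_apply, Matrix.mul_apply, Fin.sum_univ_two, hS10, hT10] <;> ring

/-- **Lagrange identity**: `⟪X(S,T), X(U,V)⟫ = 4(⟪S,U⟫⟪T,V⟫ − ⟪S,V⟫⟪T,U⟫)`, `⟪S,T⟫ = (det(S+T) − det S − det T)/2`. [folklore] -/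
theorem cross_pairing (S T U V : Matrix (Fin 2) (Fin 2) ℝ) (hS : S.IsSymm) (hT : T.IsSymm) (hU : U.IsSymm) (hV : V.IsSymm) :
    ((S * !![0, 1; -1, 0] * T - T * !![0, 1; -1, 0] * S + (U * !![0, 1; -1, 0] * V - V * !![0, 1; -1, 0] * U)).det
        - (S * !![0, 1; -1, 0] * T - T * !![0, 1; -1, 0] * S).det - (U * !![0, 1; -1, 0] * V - V * !![0, 1; -1, 0] * U).det) / 2
      = 4 * (((S + U).det - S.det - U.det) / 2 * (((T + V).det - T.det - V.det) / 2)
            - ((S + V).det - S.det - V.det) / 2 * (((T + U).det - T.det - U.det) / 2)) := by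
  have hS10 : S 1 0 = S 0 1 := by simpa using congrFun (congrFun hS 0) 1
  have hT10 : T 1 0 = T 0 1 := by simpa using congrFun (congrFun hT 0) 1
  have hU10 : U 1 0 = U 0 1 := by simpa using congrFun (congrFun hU 0) 1
  have hV10 : V 1 0 = V 0 1 := by simpa using congrFun (congrFun hV 0) 1
  simp only [Matrix.det_fin_two, Matrix.add_apply, Matrix.sub_apply, Matrix.mul_apply, Fin.sum_univ_two,
    Matrix.of_apply, Matrix.cons_val', Matrix.cons_val_zero, Matrix.cons_val_one, Matrix.empty_val',
    Matrix.cons_val_fin_one, hS10, hT10, hU10, hV10]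
  ring

/-- **`det X(S,T) = 4·(det S·det T − ⟪S,T⟫²)`** — the cross product's norm is (four times) the Gram determinant. [folklore] -/
theorem det_cross (S T : Matrix (Fin 2) (Fin 2) ℝ) (hS : S.IsSymm) (hT : T.IsSymm) :
    (S * !![0, 1; -1, 0] * T - T * !![0, 1; -1, 0] * S).det
      = 4 * (S.det * T.det - (((S + T).det - S.det - T.det) / 2) ^ 2) := by
  have hS10 : S 1 0 = S 0 1 := by simpa using congrFun (congrFun hS 0) 1
  have hT10 : T 1 0 = T 0 1 := by simpa using congrFun (congrFun hT 0) 1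
  simp only [Matrix.det_fin_two, Matrix.add_apply, Matrix.sub_apply, Matrix.mul_apply, Fin.sum_univ_two,
    Matrix.of_apply, Matrix.cons_val', Matrix.cons_val_zero, Matrix.cons_val_one, Matrix.empty_val',
    Matrix.cons_val_fin_one, hS10, hT10]
  ring


/-! ## §2 Gauge existence at a point: `2 × 2` pencils containing a definite matrix -/

/-- Polarisation of the `2 × 2` determinant along a line: `det(A + s•B) = det A + s·(det(A+B) − det A − det B) + s²·det B`. [folklore] -/
theorem det_add_smul_two (A B : Matrix (Fin 2) (Fin 2) ℝ) (s : ℝ) :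
    (A + s • B).det = A.det + s * ((A + B).det - A.det - B.det) + s ^ 2 * B.det := by
  simp only [Matrix.det_fin_two, Matrix.add_apply, Matrix.smul_apply, smul_eq_mul]
  ring

/-- **Gauge existence.**  For real `2 × 2` matrices with `det B < 0` the line `A + s•B` contains a matrix of POSITIVE determinant (for
symmetric matrices: a DEFINITE one) iff the Gram determinant is negative: `det A·det B − ⟪A,B⟫² < 0`, `⟪A,B⟫ = (det(A+B) − det A − det B)/2`.
[folklore] -/
theorem exists_det_pos_iff (A B : Matrix (Fin 2) (Fin 2) ℝ) (hB : B.det < 0) :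
    (∃ s : ℝ, 0 < (A + s • B).det) ↔ A.det * B.det - (((A + B).det - A.det - B.det) / 2) ^ 2 < 0 := by
  set a := B.det with ha
  set c := A.det with hc
  set p := (A + B).det - A.det - B.det with hp
  constructor
  · rintro ⟨s, hs⟩
    rw [det_add_smul_two] at hs
    by_contra hge
    push Not at hge
    nlinarith [sq_nonneg (2 * a * s + p), mul_pos_of_neg_of_neg (by linarith : 4 * a < 0) (by linarith : -(c + s * p + s ^ 2 * a) < 0)]
  · intro hlt
    refine ⟨-p / (2 * a), ?_⟩
    rw [det_add_smul_two]
    have ha0 : a ≠ 0 := hB.ne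
    have h4a : 4 * a < 0 := by linarith
    have hval : c + -p / (2 * a) * p + (-p / (2 * a)) ^ 2 * a = (4 * a * c - p ^ 2) / (4 * a) := by
      field_simp
      ring
    rw [hval]
    apply div_pos_of_neg_of_neg _ h4a
    nlinarith

/-- **Definite gauge ⟺ negative cross-product determinant.**  For symmetric `A, B` with `B` indefinite (`det B < 0`): some `A − θ'•B` is
definite (`det > 0`) iff `det X(A,B) < 0`.  (With `A = (θF)(x)`, `B = F(x)`: a definite gauged Euler derivative `Q_θ'(x)` exists at an
indefinite point `x` iff the cross-product pencil has negative determinant there.) [folklore] -/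
theorem exists_definite_gauge_iff (A B : Matrix (Fin 2) (Fin 2) ℝ) (hA : A.IsSymm) (hB : B.IsSymm) (hBdet : B.det < 0) :
    (∃ θ' : ℝ, 0 < (A - θ' • B).det) ↔ (A * !![0, 1; -1, 0] * B - B * !![0, 1; -1, 0] * A).det < 0 := by
  rw [det_cross A B hA hB]
  have h : (∃ θ' : ℝ, 0 < (A - θ' • B).det) ↔ (∃ s : ℝ, 0 < (A + s • B).det) := by
    constructor
    · rintro ⟨θ', h⟩; exact ⟨-θ', by rwa [neg_smul, ← sub_eq_add_neg]⟩
    · rintro ⟨s, h⟩; exact ⟨-s, by rwa [neg_smul, sub_neg_eq_add]⟩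
  rw [h, exists_det_pos_iff A B hBdet]
  constructor
  · intro h1; linarith
  · intro h1; linarith

/-! ## §3 The cross-product pencil of a lacunary pencil and its Euler derivative -/

/-- **The cross-product pencil.**  For `F(x) = ∑ₗ x^{dₗ}Sₗ` and `(θF)(x) = ∑ₖ dₖx^{dₖ}Sₖ`:
`F·J·(θF) − (θF)·J·F = ∑ₗ ∑ₖ ((dₖ − dₗ)·x^{dₗ+dₖ}) • (Sₗ·J·Sₖ)` — grouping `(l,k)` with `(k,l)` this is
`∑_{l<k} (dₖ − dₗ)x^{dₗ+dₖ} • X(Sₗ,Sₖ)`, a lacunary pencil on the off-diagonal pair sums. [folklore] -/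
theorem crossPencil_eq {K : ℕ} (d : Fin K → ℕ) (S : Fin K → Matrix (Fin 2) (Fin 2) ℝ) (x : ℝ) :
    (∑ l, x ^ (d l) • S l) * !![0, 1; -1, 0] * (∑ k, ((d k : ℝ) * x ^ (d k)) • S k)
        - (∑ k, ((d k : ℝ) * x ^ (d k)) • S k) * !![0, 1; -1, 0] * (∑ l, x ^ (d l) • S l)
      = ∑ l, ∑ k, (((d k : ℝ) - d l) * x ^ (d l + d k)) • (S l * !![0, 1; -1, 0] * S k) := by
  set J : Matrix (Fin 2) (Fin 2) ℝ := !![0, 1; -1, 0] with hJ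
  have h1 : (∑ l, x ^ (d l) • S l) * J * (∑ k, ((d k : ℝ) * x ^ (d k)) • S k)
      = ∑ l, ∑ k, (x ^ (d l) * ((d k : ℝ) * x ^ (d k))) • (S l * J * S k) := by
    rw [Finset.sum_mul, Finset.sum_mul]
    refine Finset.sum_congr rfl fun l _ => ?_
    rw [Finset.mul_sum]
    refine Finset.sum_congr rfl fun k _ => ?_
    rw [Matrix.smul_mul, Matrix.smul_mul, Matrix.mul_smul, smul_smul]
  have h2 : (∑ k, ((d k : ℝ) * x ^ (d k)) • S k) * J * (∑ l, x ^ (d l) • S l)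
      = ∑ l, ∑ k, (((d l : ℝ) * x ^ (d l)) * x ^ (d k)) • (S l * J * S k) := by
    rw [Finset.sum_mul, Finset.sum_mul]
    refine Finset.sum_congr rfl fun l _ => ?_
    rw [Finset.mul_sum]
    refine Finset.sum_congr rfl fun k _ => ?_
    rw [Matrix.smul_mul, Matrix.smul_mul, Matrix.mul_smul, smul_smul]
  rw [h1, h2, ← Finset.sum_sub_distrib]
  refine Finset.sum_congr rfl fun l _ => ?_
  rw [← Finset.sum_sub_distrib]
  refine Finset.sum_congr rfl fun k _ => ?_
  rw [← sub_smul, pow_add]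
  ring_nf

/-- Symmetry of a real pencil value. [folklore] -/
theorem isSymm_sum_smul {K : ℕ} (a : Fin K → ℝ) (S : Fin K → Matrix (Fin 2) (Fin 2) ℝ) (hS : ∀ l, (S l).IsSymm) :
    (∑ l, a l • S l).IsSymm := by
  unfold Matrix.IsSymm
  rw [Matrix.transpose_sum]
  exact Finset.sum_congr rfl fun l _ => by rw [Matrix.transpose_smul, (hS l).eq]

/-- **`det` of the cross-product pencil = `4·Gram(F, θF)`**: at every `x`,
`det (F·J·θF − θF·J·F) = 4·(det F · det θF − ⟪F, θF⟫²)` — the TANGENCY / GAUGE-EXISTENCE DISCRIMINANT of the pencil. [folklore] -/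
theorem det_crossPencil {K : ℕ} (d : Fin K → ℕ) (S : Fin K → Matrix (Fin 2) (Fin 2) ℝ) (hS : ∀ l, (S l).IsSymm) (x : ℝ) :
    ((∑ l, x ^ (d l) • S l) * !![0, 1; -1, 0] * (∑ k, ((d k : ℝ) * x ^ (d k)) • S k)
        - (∑ k, ((d k : ℝ) * x ^ (d k)) • S k) * !![0, 1; -1, 0] * (∑ l, x ^ (d l) • S l)).det
      = 4 * ((∑ l, x ^ (d l) • S l).det * (∑ k, ((d k : ℝ) * x ^ (d k)) • S k).det
          - ((((∑ l, x ^ (d l) • S l) + ∑ k, ((d k : ℝ) * x ^ (d k)) • S k).det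
              - (∑ l, x ^ (d l) • S l).det - (∑ k, ((d k : ℝ) * x ^ (d k)) • S k).det) / 2) ^ 2) :=
  det_cross _ _ (isSymm_sum_smul _ S hS) (isSymm_sum_smul _ S hS)


/-! ## §4 Revivals cost a semidefinite point of the cross-product pencil -/

/-- A real symmetric `2 × 2` matrix of positive determinant has non-zero trace (it is definite). [folklore] -/
theorem trace_ne_zero_of_det_pos (M : Matrix (Fin 2) (Fin 2) ℝ) (hM : M 1 0 = M 0 1) (hdet : 0 < M.det) :
    M.trace ≠ 0 := by
  rw [Matrix.det_fin_two, hM] at hdet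
  rw [Matrix.trace_fin_two]
  intro h
  have h11 : M 1 1 = -M 0 0 := by linarith
  rw [h11] at hdet
  nlinarith [sq_nonneg (M 0 0), sq_nonneg (M 0 1)]

/-- If `det B ≤ 0` and the Gram determinant `det A·det B − ⟪A,B⟫²` is negative, the line `A + s•B` contains a matrix of positive
determinant (for `det B = 0` the determinant is affine in `s` with non-zero slope). [folklore] -/
theorem exists_det_pos_of_gram_neg (A B : Matrix (Fin 2) (Fin 2) ℝ) (hB : B.det ≤ 0)
    (h : A.det * B.det - (((A + B).det - A.det - B.det) / 2) ^ 2 < 0) : ∃ s : ℝ, 0 < (A + s • B).det := by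
  rcases hB.lt_or_eq with hlt | heq
  · exact (exists_det_pos_iff A B hlt).2 h
  · set p := (A + B).det - A.det - B.det with hp
    have hp0 : p ≠ 0 := by
      intro h0
      rw [heq, h0] at h
      norm_num at h
    refine ⟨(1 - A.det) / p, ?_⟩
    rw [det_add_smul_two, ← hp, heq, mul_zero, add_zero, div_mul_cancel₀ _ hp0]
    norm_num

/-- Concavity of `s ↦ det(A + s•B)` when `det B ≤ 0`. [folklore] -/
theorem det_add_smul_concave (A B : Matrix (Fin 2) (Fin 2) ℝ) (hB : B.det ≤ 0) (a b t : ℝ) (ht0 : 0 ≤ t) (ht1 : t ≤ 1) :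
    t * (A + a • B).det + (1 - t) * (A + b • B).det ≤ (A + (t * a + (1 - t) * b) • B).det := by
  rw [det_add_smul_two, det_add_smul_two, det_add_smul_two]
  nlinarith [mul_nonneg (mul_nonneg ht0 (sub_nonneg.2 ht1)) (sq_nonneg (a - b)),
    mul_nonpos_of_nonneg_of_nonpos (mul_nonneg (mul_nonneg ht0 (sub_nonneg.2 ht1)) (sq_nonneg (a - b))) hB]

/-- **Opposite gauges cannot both be available where `det ≤ 0`.**  If `det B ≤ 0` and `A, B` are symmetric, the line `A + s•B` cannot
contain both a positive definite and a negative definite matrix (recorded through `det > 0` and the sign of the trace). [folklore] -/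
theorem not_both_gauges (A B : Matrix (Fin 2) (Fin 2) ℝ) (hA : A 1 0 = A 0 1) (hB1 : B 1 0 = B 0 1) (hB : B.det ≤ 0)
    {s₁ s₂ : ℝ} (h₁ : 0 < (A + s₁ • B).det) (ht₁ : 0 < (A + s₁ • B).trace)
    (h₂ : 0 < (A + s₂ • B).det) (ht₂ : (A + s₂ • B).trace < 0) : False := by
  have htr : ∀ s : ℝ, (A + s • B).trace = A.trace + s * B.trace := by
    intro s; rw [Matrix.trace_add, Matrix.trace_smul, smul_eq_mul]
  rw [htr] at ht₁ ht₂
  set T₁ := A.trace + s₁ * B.trace with hT₁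
  set T₂ := A.trace + s₂ * B.trace with hT₂
  have hden : 0 < T₁ - T₂ := by linarith
  set t := -T₂ / (T₁ - T₂) with ht
  have ht0 : 0 ≤ t := div_nonneg (by linarith) hden.le
  have ht1 : t ≤ 1 := by rw [ht, div_le_one hden]; linarith
  have hzero : A.trace + (t * s₁ + (1 - t) * s₂) * B.trace = 0 := by
    have : A.trace + (t * s₁ + (1 - t) * s₂) * B.trace = t * T₁ + (1 - t) * T₂ := by rw [hT₁, hT₂]; ring
    rw [this, ht]
    field_simp
    ring
  have hconc := det_add_smul_concave A B hB s₁ s₂ t ht0 ht1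
  have hpos : 0 < (A + (t * s₁ + (1 - t) * s₂) • B).det := by
    have h3 : 0 ≤ t * (A + s₁ • B).det := mul_nonneg ht0 h₁.le
    have h4 : 0 ≤ (1 - t) * (A + s₂ • B).det := mul_nonneg (sub_nonneg.2 ht1) h₂.le
    rcases eq_or_lt_of_le ht0 with h0 | h0
    · have : (1 - t) * (A + s₂ • B).det > 0 := mul_pos (by rw [← h0]; norm_num) h₂
      linarith
    · have : t * (A + s₁ • B).det > 0 := mul_pos h0 h₁
      linarith
  have hsym : (A + (t * s₁ + (1 - t) * s₂) • B) 1 0 = (A + (t * s₁ + (1 - t) * s₂) • B) 0 1 := by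
    simp only [Matrix.add_apply, Matrix.smul_apply, smul_eq_mul, hA, hB1]
  have hne := trace_ne_zero_of_det_pos _ hsym hpos
  rw [htr] at hne
  exact hne hzero

/-- **REVIVAL LEMMA.**  `F(x) = ∑ₗ x^{dₗ}Sₗ` (real symmetric `2 × 2` letters), `θF` its Euler derivative, `r ≤ r'` with `det F ≤ 0` on
`[r, r']`; a NEGATIVE definite gauge `θF(r) + s•F(r)` available at `r` and a POSITIVE definite one at `r'` (at singular end points: the roots'
TYPES, §5) ⇒ `det(θF·J·F − F·J·θF) ≥ 0` somewhere in `[r, r']` (no gauge is definite there). [folklore] -/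
theorem exists_crossDet_nonneg_of_revival {K : ℕ} (d : Fin K → ℕ) (S : Fin K → Matrix (Fin 2) (Fin 2) ℝ)
    (hS : ∀ l, (S l).IsSymm) {r r' : ℝ} (hrr' : r ≤ r')
    (hgap : ∀ x, r ≤ x → x ≤ r' → (∑ l, x ^ (d l) • S l).det ≤ 0)
    (hneg : ∃ s : ℝ, 0 < ((∑ k, ((d k : ℝ) * r ^ (d k)) • S k) + s • ∑ l, r ^ (d l) • S l).det ∧
      ((∑ k, ((d k : ℝ) * r ^ (d k)) • S k) + s • ∑ l, r ^ (d l) • S l).trace < 0)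
    (hpos : ∃ s : ℝ, 0 < ((∑ k, ((d k : ℝ) * r' ^ (d k)) • S k) + s • ∑ l, r' ^ (d l) • S l).det ∧
      0 < ((∑ k, ((d k : ℝ) * r' ^ (d k)) • S k) + s • ∑ l, r' ^ (d l) • S l).trace) :
    ∃ x, r ≤ x ∧ x ≤ r' ∧
      0 ≤ ((∑ k, ((d k : ℝ) * x ^ (d k)) • S k) * !![0, 1; -1, 0] * (∑ l, x ^ (d l) • S l)
            - (∑ l, x ^ (d l) • S l) * !![0, 1; -1, 0] * (∑ k, ((d k : ℝ) * x ^ (d k)) • S k)).det := by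
  set F : ℝ → Matrix (Fin 2) (Fin 2) ℝ := fun x => ∑ l, x ^ (d l) • S l with hF
  set E : ℝ → Matrix (Fin 2) (Fin 2) ℝ := fun x => ∑ k, ((d k : ℝ) * x ^ (d k)) • S k with hE
  have hFsym : ∀ x, (F x) 1 0 = (F x) 0 1 := fun x => (isSymm_sum_smul _ S hS).apply 0 1
  have hEsym : ∀ x, (E x) 1 0 = (E x) 0 1 := fun x => (isSymm_sum_smul _ S hS).apply 0 1
  by_contra hcon
  push Not at hcon
  set Up : Set ℝ := {x | ∃ s : ℝ, 0 < (E x + s • F x).det ∧ 0 < (E x + s • F x).trace} with hUp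
  set Um : Set ℝ := {x | ∃ s : ℝ, 0 < (E x + s • F x).det ∧ (E x + s • F x).trace < 0} with hUm
  have hcontM : ∀ s : ℝ, Continuous fun x : ℝ => E x + s • F x := by
    intro s
    show Continuous fun x : ℝ => (∑ k, ((d k : ℝ) * x ^ (d k)) • S k) + s • ∑ l, x ^ (d l) • S l
    fun_prop
  have hopen : ∀ (σ : ℝ), IsOpen {x : ℝ | ∃ s : ℝ, 0 < (E x + s • F x).det ∧ 0 < σ * (E x + s • F x).trace} := by
    intro σ
    have : {x : ℝ | ∃ s : ℝ, 0 < (E x + s • F x).det ∧ 0 < σ * (E x + s • F x).trace}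
        = ⋃ s : ℝ, ({x | 0 < (E x + s • F x).det} ∩ {x | 0 < σ * (E x + s • F x).trace}) := by
      ext x; simp [Set.mem_iUnion]
    rw [this]
    refine isOpen_iUnion fun s => IsOpen.inter ?_ ?_
    · exact isOpen_lt continuous_const ((hcontM s).matrix_det)
    · exact isOpen_lt continuous_const (continuous_const.mul ((hcontM s).matrix_trace))
  have hUp_open : IsOpen Up := by
    have h := hopen 1; simp only [one_mul] at h; exact h
  have hUm_open : IsOpen Um := by
    have h := hopen (-1)
    have heq : Um = {x : ℝ | ∃ s : ℝ, 0 < (E x + s • F x).det ∧ 0 < (-1) * (E x + s • F x).trace} := by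
      ext x
      simp only [hUm, Set.mem_setOf_eq, neg_mul, one_mul, neg_pos]
    rw [heq]; exact h
  have hcover : Set.Icc r r' ⊆ Um ∪ Up := by
    intro x hx
    have hFle : (F x).det ≤ 0 := hgap x hx.1 hx.2
    have hcross := hcon x hx.1 hx.2
    have hgram : (E x).det * (F x).det - (((E x + F x).det - (E x).det - (F x).det) / 2) ^ 2 < 0 := by
      have h4 := det_cross (E x) (F x) (isSymm_sum_smul _ S hS) (isSymm_sum_smul _ S hS)
      show (E x).det * (F x).det - (((E x + F x).det - (E x).det - (F x).det) / 2) ^ 2 < 0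
      have : (E x * !![0, 1; -1, 0] * F x - F x * !![0, 1; -1, 0] * E x).det < 0 := hcross
      linarith
    obtain ⟨s, hs⟩ := exists_det_pos_of_gram_neg (E x) (F x) hFle hgram
    have hsym : (E x + s • F x) 1 0 = (E x + s • F x) 0 1 := by
      simp only [Matrix.add_apply, Matrix.smul_apply, smul_eq_mul, hEsym, hFsym]
    have hne := trace_ne_zero_of_det_pos _ hsym hs
    rcases hne.lt_or_gt with hlt | hgt
    · exact Or.inl ⟨s, hs, hlt⟩
    · exact Or.inr ⟨s, hs, hgt⟩
  have hconn := isPreconnected_Icc (a := r) (b := r')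
  have hne1 : (Set.Icc r r' ∩ Um).Nonempty := ⟨r, ⟨le_rfl, hrr'⟩, hneg⟩
  have hne2 : (Set.Icc r r' ∩ Up).Nonempty := ⟨r', ⟨hrr', le_rfl⟩, hpos⟩
  obtain ⟨x, hx, hxm, hxp⟩ := hconn Um Up hUm_open hUp_open hcover hne1 hne2
  obtain ⟨s₁, h₁, ht₁⟩ := hxp
  obtain ⟨s₂, h₂, ht₂⟩ := hxm
  exact not_both_gauges (E x) (F x) (hEsym x) (hFsym x) (hgap x hx.1 hx.2) h₁ ht₁ h₂ ht₂


/-! ## §5 At a singular point the available gauge sign is the TYPE of the root -/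

/-- **Type ⇒ gauge (negative type).**  `F₀` real symmetric singular non-zero with kernel vector `u ≠ 0`, `E₀` real symmetric with
`uᵀE₀u < 0` ⇒ some `E₀ + s•F₀` has positive determinant and negative trace (a negative definite gauge). [folklore] -/
theorem exists_negGauge_of_negType (E₀ F₀ : Matrix (Fin 2) (Fin 2) ℝ) (hE : E₀ 1 0 = E₀ 0 1) (hF : F₀ 1 0 = F₀ 0 1)
    (hF0 : F₀ ≠ 0) (u : Fin 2 → ℝ) (hu : u ≠ 0) (hker : F₀ *ᵥ u = 0) (htype : u ⬝ᵥ (E₀ *ᵥ u) < 0) :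
    ∃ s : ℝ, 0 < (E₀ + s • F₀).det ∧ (E₀ + s • F₀).trace < 0 := by
  have h1 : F₀ 0 0 * u 0 + F₀ 0 1 * u 1 = 0 := by
    have := congrFun hker 0; simpa [Matrix.mulVec, dotProduct, Fin.sum_univ_two] using this
  have h2 : F₀ 0 1 * u 0 + F₀ 1 1 * u 1 = 0 := by
    have := congrFun hker 1; simpa [Matrix.mulVec, dotProduct, Fin.sum_univ_two, hF] using this
  have hn2pos : 0 < u 0 ^ 2 + u 1 ^ 2 := by
    rcases Function.ne_iff.1 hu with ⟨i, hi⟩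
    fin_cases i
    · have h0 : 0 < u 0 ^ 2 := lt_of_le_of_ne (sq_nonneg _) (Ne.symm (pow_ne_zero 2 hi))
      linarith [sq_nonneg (u 1)]
    · have h0 : 0 < u 1 ^ 2 := lt_of_le_of_ne (sq_nonneg _) (Ne.symm (pow_ne_zero 2 hi))
      linarith [sq_nonneg (u 0)]
  obtain ⟨κ, hκ⟩ : ∃ κ : ℝ, κ = (F₀ 0 0 + F₀ 1 1) / (u 0 ^ 2 + u 1 ^ 2) := ⟨_, rfl⟩
  have ha : F₀ 0 0 = κ * u 1 ^ 2 := by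
    have h : F₀ 0 0 * (u 0 ^ 2 + u 1 ^ 2) = (F₀ 0 0 + F₀ 1 1) * u 1 ^ 2 := by
      linear_combination (u 0) * h1 - (u 1) * h2
    rw [hκ, div_mul_eq_mul_div, eq_div_iff hn2pos.ne', h]
  have hb : F₀ 0 1 = -(κ * (u 0 * u 1)) := by
    have h : F₀ 0 1 * (u 0 ^ 2 + u 1 ^ 2) = -((F₀ 0 0 + F₀ 1 1) * (u 0 * u 1)) := by
      linear_combination (u 1) * h1 + (u 0) * h2
    have h' : κ * (u 0 * u 1) = (F₀ 0 0 + F₀ 1 1) * (u 0 * u 1) / (u 0 ^ 2 + u 1 ^ 2) := by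
      rw [hκ]; ring
    rw [h', ← neg_div, eq_div_iff hn2pos.ne', h]
  have hc : F₀ 1 1 = κ * u 0 ^ 2 := by
    have h : F₀ 1 1 * (u 0 ^ 2 + u 1 ^ 2) = (F₀ 0 0 + F₀ 1 1) * u 0 ^ 2 := by
      linear_combination (-(u 0)) * h1 + (u 1) * h2
    rw [hκ, div_mul_eq_mul_div, eq_div_iff hn2pos.ne', h]
  have hF10 : F₀ 1 0 = -(κ * (u 0 * u 1)) := by rw [hF, hb]
  have hκ0 : κ ≠ 0 := by
    intro h0
    apply hF0
    ext i j
    fin_cases i <;> fin_cases j <;> simp [ha, hb, hc, hF10, h0]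
  have hτeq : u ⬝ᵥ (E₀ *ᵥ u) = E₀ 0 0 * u 0 ^ 2 + 2 * E₀ 0 1 * (u 0 * u 1) + E₀ 1 1 * u 1 ^ 2 := by
    simp [Matrix.mulVec, dotProduct, Fin.sum_univ_two, hE]; ring
  have hdet : ∀ s : ℝ, (E₀ + s • F₀).det = E₀.det + s * (κ * (u ⬝ᵥ (E₀ *ᵥ u))) := by
    intro s
    rw [Matrix.det_fin_two, Matrix.det_fin_two, hτeq]
    simp only [Matrix.add_apply, Matrix.smul_apply, smul_eq_mul, hE, hF10, ha, hb, hc]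
    ring
  have htr : ∀ s : ℝ, (E₀ + s • F₀).trace = E₀.trace + s * (κ * (u 0 ^ 2 + u 1 ^ 2)) := by
    intro s
    rw [Matrix.trace_fin_two, Matrix.trace_fin_two]
    simp only [Matrix.add_apply, Matrix.smul_apply, smul_eq_mul, ha, hc]
    ring
  set τ : ℝ := u ⬝ᵥ (E₀ *ᵥ u) with hτ
  set n2 : ℝ := u 0 ^ 2 + u 1 ^ 2 with hn2
  have hκ2 : 0 < κ ^ 2 := lt_of_le_of_ne (sq_nonneg _) (Ne.symm (pow_ne_zero 2 hκ0))
  have hA : 0 < κ ^ 2 * (-τ) := mul_pos hκ2 (by linarith)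
  have hB : 0 < κ ^ 2 * n2 := mul_pos hκ2 hn2pos
  set N : ℝ := (|E₀.det| + 1) / (κ ^ 2 * (-τ)) + (|E₀.trace| + 1) / (κ ^ 2 * n2) with hN
  have hN1 : |E₀.det| + 1 ≤ N * (κ ^ 2 * (-τ)) := by
    have h3 : (|E₀.det| + 1) / (κ ^ 2 * (-τ)) * (κ ^ 2 * (-τ)) = |E₀.det| + 1 := div_mul_cancel₀ _ hA.ne'
    have h4 : 0 ≤ (|E₀.trace| + 1) / (κ ^ 2 * n2) * (κ ^ 2 * (-τ)) :=
      mul_nonneg (div_nonneg (by positivity) hB.le) hA.le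
    rw [hN, add_mul]; linarith
  have hN2 : |E₀.trace| + 1 ≤ N * (κ ^ 2 * n2) := by
    have h3 : (|E₀.trace| + 1) / (κ ^ 2 * n2) * (κ ^ 2 * n2) = |E₀.trace| + 1 := div_mul_cancel₀ _ hB.ne'
    have h4 : 0 ≤ (|E₀.det| + 1) / (κ ^ 2 * (-τ)) * (κ ^ 2 * n2) :=
      mul_nonneg (div_nonneg (by positivity) hA.le) hB.le
    rw [hN, add_mul]; linarith
  refine ⟨-N * κ, ?_, ?_⟩
  · rw [hdet, show -N * κ * (κ * τ) = N * (κ ^ 2 * (-τ)) by ring]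
    linarith [neg_abs_le E₀.det]
  · rw [htr, show -N * κ * (κ * n2) = -(N * (κ ^ 2 * n2)) by ring]
    linarith [le_abs_self E₀.trace]

/-- **Type ⇒ gauge (positive type).**  Mirror: `uᵀE₀u > 0` ⇒ a positive definite gauge `E₀ + s•F₀`. [folklore] -/
theorem exists_posGauge_of_posType (E₀ F₀ : Matrix (Fin 2) (Fin 2) ℝ) (hE : E₀ 1 0 = E₀ 0 1) (hF : F₀ 1 0 = F₀ 0 1)
    (hF0 : F₀ ≠ 0) (u : Fin 2 → ℝ) (hu : u ≠ 0) (hker : F₀ *ᵥ u = 0) (htype : 0 < u ⬝ᵥ (E₀ *ᵥ u)) :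
    ∃ s : ℝ, 0 < (E₀ + s • F₀).det ∧ 0 < (E₀ + s • F₀).trace := by
  have hE' : (-E₀) 1 0 = (-E₀) 0 1 := by simp [hE]
  have hF' : (-F₀) 1 0 = (-F₀) 0 1 := by simp [hF]
  have hF0' : -F₀ ≠ 0 := neg_ne_zero.2 hF0
  have hker' : (-F₀) *ᵥ u = 0 := by rw [Matrix.neg_mulVec, hker, neg_zero]
  have htype' : u ⬝ᵥ ((-E₀) *ᵥ u) < 0 := by rw [Matrix.neg_mulVec, dotProduct_neg]; linarith
  obtain ⟨s, hs, ht⟩ := exists_negGauge_of_negType (-E₀) (-F₀) hE' hF' hF0' u hu hker' htype'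
  have heq : -E₀ + s • -F₀ = -(E₀ + s • F₀) := by rw [smul_neg, neg_add]
  refine ⟨s, ?_, ?_⟩
  · rw [heq, Matrix.det_neg, Fintype.card_fin] at hs
    simpa using hs
  · rw [heq, Matrix.trace_neg] at ht
    linarith

end Summit.ValiantsHypothesis.ValiantsHypothesis.Theorems.LacunarySymmetroidMatrixDescartes.Census.CrossPencil
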